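import Summits.ResolutionOfSingularities.ResolutionOfSingularities.Theorems.FrobeniusLadderFInjectiveMacaulayficationWeightedConeCore
import Mathlib.RingTheory.Jacobson.Ring
import Mathlib.RingTheory.MvPolynomial.WeightedHomogeneous
import Mathlib.Algebra.CharP.Algebra
import HarnessLib

/-!
# The weighted cone engine for a graded domain `k[X]/J`, core form (crux `FInjectiveMacaulayfication`, line H4-gd, piece G5ᵍ-core)

Support file for crux stmt-ResolutionOfSingularities-15315 (`FrobeniusLadder.FInjectiveMacaulayfication`), line (H4-gd) THE
GRADED ENGINE FOR A POSITIVELY GRADED AFFINE DOMAIN OF ANY EMBEDDING CODIMENSION (CRUX-PLAN w45a v7 R7.6, typed target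
`stub_gradedDomainConeFiModel`; seat res-L1-w45a-stub-2). [OURS · L1 W4.5a] AI-written; AI review is weaker than expert review.
No statement of Hironaka2017 is used; no external fact is consumed.

This is the generalisation of `…WeightedConeCore.weightedConeFiModel_of_chartClause` (res-L1-w45a-lead-1, p460946, hypersurface
case `J = (f)`) from `R = k[X]/(f)` to `R = k[X]/J` for an ARBITRARY PRIME ideal `J` (no homogeneity is needed here). Let `k` be a
field of characteristic `p`, `S = k[X₀,…,X_{n-1}]` with weights `w`, `N > 0` with `N = c_v · w_v` for every variable, and
`I_N ⊆ S` the monomial ideal spanned by the monomials of weighted degree `≥ N`, with the Veronese saturation `X^b ∈ I_N^K`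
whenever `wt b ≥ K·N`. For `J` prime with all `x̄_v ≠ 0` in `R = S/J`, THE CORE THEOREM `gradedDomainConeFiModel_of_chartClause`
says: if `R` satisfies the per-stalk clause of the crux at its closed points off the vertex, and every affine blow-up algebra
`R[I_N R / x̄_v^{c_v}] ⊆ R[1/x̄_v]` satisfies the Cohen–Macaulay + Frobenius-closed clause at its maximal ideals containing
`x̄_v^{c_v}`, then `affineBlowup (I_N R)` is an F-injective Macaulayfication of `Spec R` (proper, birational, every stalk a
domain with the clause).

Proof (verbatim from `…WeightedConeCore` with `Ideal.span {f}` replaced by `J`): E6‴ `BlowupFiModelOfCover.stub_blowupFiModelOfCover`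
on the sub-family `v_j = x̄_j^{c_j}`, which covers `Bl_{I_N}` by `ReesCoverOfPowers.stub_reesCoverOfPowers` and the saturation;
the primes `P ⊉ I_N R` are handled by the Jacobson property of `R` (`exists_maximal_not_mem_X`) and
`ClauseOfMaximal.fiClause_atPrime_of_le`; `n = 0` is the case `R ≅ k` (a prime ideal of the field `k[X_∅] ≅ k` is `⊥`).
No definitions, no named facts. [folklore]
-/

set_option linter.dupNamespace false

open AlgebraicGeometry CategoryTheory Literature.AlgebraicGeometry.Resolution MvPolynomial

namespace Summit.ResolutionOfSingularities.ResolutionOfSingularities.Theorems.FInjectiveMacaulayfication.GradedDomainConeCore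

/-- **Off the vertex via Jacobson**: in the Jacobson ring `R = k[X]/J`, a prime `P` not containing an
ideal `I ⊆ (x̄₀,…,x̄_{n-1})` lies in a maximal ideal `Q` missing some variable `x̄ⱼ` (a prime of a Jacobson
ring is the intersection of the maximal ideals containing it). [folklore] -/
theorem exists_maximal_not_mem_X {k : Type} [Field k] {n : ℕ} (J : Ideal (MvPolynomial (Fin n) k))
    (I : Ideal (MvPolynomial (Fin n) k ⧸ J))
    (hI : I ≤ Ideal.span (Set.range fun j : Fin n => Ideal.Quotient.mk J (X j)))
    (P : Ideal (MvPolynomial (Fin n) k ⧸ J)) [P.IsPrime] (hP : ¬ I ≤ P) :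
    ∃ (Q : Ideal (MvPolynomial (Fin n) k ⧸ J)), Q.IsMaximal ∧ P ≤ Q ∧
      ∃ j : Fin n, Ideal.Quotient.mk J (X j) ∉ Q := by
  by_contra hcon
  push Not at hcon
  apply hP
  have hJ : P.jacobson = P := IsJacobsonRing.out inferInstance (Ideal.IsPrime.isRadical ‹_›)
  refine hI.trans ?_
  rw [← hJ, Ideal.jacobson, Ideal.span_le]
  rintro _ ⟨j, rfl⟩
  simp only [SetLike.mem_coe, Ideal.mem_sInf, Set.mem_setOf_eq]
  rintro Q ⟨hPQ, hQ⟩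
  exact hcon Q hQ hPQ j

/-- **THE WEIGHTED CONE ENGINE FOR A GRADED DOMAIN, CORE FORM** (see the module docstring): weights `w`,
`N = c_v · w_v > 0`, `I_N` with Veronese saturation, `J` prime with all `x̄_v ≠ 0`; if `R = k[X]/J` satisfies the clause at
the maximal ideals off the vertex and every affine blow-up algebra `R[I_N R/x̄_v^{c_v}]` satisfies the
Cohen–Macaulay + Frobenius-closed clause at its maximal ideals containing `x̄_v^{c_v}`, then `Spec R` admits
a proper birational model all of whose stalks are domains satisfying the per-stalk clause of
`FrobeniusLadder.FInjectiveMacaulayfication` (namely `affineBlowup (I_N R)`). [folklore] -/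
theorem gradedDomainConeFiModel_of_chartClause (p : ℕ) [Fact p.Prime] (k : Type) [Field k] [CharP k p] (n : ℕ)
    (w : Fin n → ℕ) (N : ℕ) (c : Fin n → ℕ) (hN : 0 < N) (hwc : ∀ v : Fin n, 0 < w v ∧ c v * w v = N)
    (hpow : ∀ (K : ℕ) (b : Fin n →₀ ℕ), K * N ≤ Finsupp.weight w b →
      (MvPolynomial.monomial b (1 : k) : MvPolynomial (Fin n) k) ∈
        (Ideal.span {m : MvPolynomial (Fin n) k | ∃ b : Fin n →₀ ℕ, N ≤ Finsupp.weight w b ∧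
          m = MvPolynomial.monomial b 1}) ^ K)
    (J : Ideal (MvPolynomial (Fin n) k)) (hJprime : J.IsPrime)
    (hXne : ∀ v : Fin n, Ideal.Quotient.mk J (MvPolynomial.X v) ≠ 0)
    (hoff : ∀ (Q : Ideal (MvPolynomial (Fin n) k ⧸ J)) [Q.IsMaximal],
      (∃ j : Fin n, Ideal.Quotient.mk J (MvPolynomial.X j) ∉ Q) →
      ∀ d : ℕ, ringKrullDim (Localization.AtPrime Q) = d → ∀ s : Fin d → Localization.AtPrime Q,
        (Ideal.span (Set.range s)).radical.IsMaximal →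
          RingTheory.Sequence.IsWeaklyRegular (Localization.AtPrime Q) (List.ofFn s) ∧
          ∀ y : Localization.AtPrime Q, (∃ e : ℕ, y ^ p ^ e ∈ Ideal.span
            ((fun z : Localization.AtPrime Q => z ^ p ^ e) ''
              (Ideal.span (Set.range s) : Set (Localization.AtPrime Q)))) → y ∈ Ideal.span (Set.range s))
    (hon : ∀ (v : Fin n) (Q : Ideal (blowupAlgebra ((Ideal.span {m : MvPolynomial (Fin n) k |
        ∃ b : Fin n →₀ ℕ, N ≤ Finsupp.weight w b ∧ m = MvPolynomial.monomial b 1}).map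
          (Ideal.Quotient.mk J)) (Ideal.Quotient.mk J (MvPolynomial.X v) ^ c v)))
        [Q.IsMaximal],
      algebraMap (MvPolynomial (Fin n) k ⧸ J) (blowupAlgebra ((Ideal.span
        {m : MvPolynomial (Fin n) k | ∃ b : Fin n →₀ ℕ, N ≤ Finsupp.weight w b ∧
          m = MvPolynomial.monomial b 1}).map (Ideal.Quotient.mk J))
            (Ideal.Quotient.mk J (MvPolynomial.X v) ^ c v))
          (Ideal.Quotient.mk J (MvPolynomial.X v) ^ c v) ∈ Q →
      ∀ d : ℕ, ringKrullDim (Localization.AtPrime Q) = d → ∀ s : Fin d → Localization.AtPrime Q,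
        (Ideal.span (Set.range s)).radical.IsMaximal →
          RingTheory.Sequence.IsWeaklyRegular (Localization.AtPrime Q) (List.ofFn s) ∧
          ∀ y : Localization.AtPrime Q, (∃ e : ℕ, y ^ p ^ e ∈ Ideal.span
            ((fun z : Localization.AtPrime Q => z ^ p ^ e) ''
              (Ideal.span (Set.range s) : Set (Localization.AtPrime Q)))) → y ∈ Ideal.span (Set.range s)) :
    ∃ (X' : Scheme.{0}) (π : X' ⟶ Spec (.of (MvPolynomial (Fin n) k ⧸ J))), IsProper π ∧
      Literature.AlgebraicGeometry.Resolution.IsBirational π ∧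
      ∀ y : X', IsDomain (X'.presheaf.stalk y) ∧ ∀ d : ℕ, ringKrullDim (X'.presheaf.stalk y) = d →
        ∀ s : Fin d → X'.presheaf.stalk y, (Ideal.span (Set.range s)).radical.IsMaximal →
          RingTheory.Sequence.IsWeaklyRegular (X'.presheaf.stalk y) (List.ofFn s) ∧
          ∀ z : X'.presheaf.stalk y, (∃ e : ℕ, z ^ p ^ e ∈
              Ideal.span ((fun w : X'.presheaf.stalk y => w ^ p ^ e) ''
                (Ideal.span (Set.range s) : Set (X'.presheaf.stalk y)))) →
            z ∈ Ideal.span (Set.range s) := by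
  haveI := hJprime
  -- `R = k[X]/(J)` is a Noetherian Jacobson domain of characteristic `p`
  haveI : IsDomain (MvPolynomial (Fin n) k ⧸ J) := Ideal.Quotient.isDomain _
  haveI : CharP (MvPolynomial (Fin n) k ⧸ J) p :=
    charP_of_injective_algebraMap (algebraMap k (MvPolynomial (Fin n) k ⧸ J)).injective p
  rcases Nat.eq_zero_or_pos n with rfl | hn
  · -- no variables: `R ≅ k` is regular and `Spec R` is its own model
    haveI : IsRegularRing (MvPolynomial (Fin 0) k ⧸ J) := by
      have hbot : (⊥ : Ideal (MvPolynomial (Fin 0) k)) = J := by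
        letI : Field (MvPolynomial (Fin 0) k) := (MvPolynomial.isEmptyRingEquiv k (Fin 0)).toMulEquiv.isField
          (Field.toIsField k) |>.toField
        exact ((Ideal.eq_bot_or_top J).resolve_right hJprime.ne_top).symm
      exact IsRegularRing.of_ringEquiv ((MvPolynomial.isEmptyRingEquiv k (Fin 0)).symm.trans
        ((RingEquiv.quotientBot _).symm.trans (Ideal.quotEquivOfEq hbot)))
    exact ⟨Spec (.of (MvPolynomial (Fin 0) k ⧸ J)), 𝟙 _, inferInstance,
      ⟨⊤, by simp [dense_univ], by simp [dense_univ], inferInstance⟩,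
      HypersurfacePointBlowup.spec_stalk_clause p (MvPolynomial (Fin 0) k ⧸ J)⟩
  -- names: the centre `I = I_N · R` and the covering sub-family `v j = x̄ⱼ ^ cⱼ`
  obtain ⟨I, hI⟩ : ∃ I : Ideal (MvPolynomial (Fin n) k ⧸ J),
      I = (Ideal.span {m : MvPolynomial (Fin n) k | ∃ b : Fin n →₀ ℕ, N ≤ Finsupp.weight w b ∧
        m = MvPolynomial.monomial b 1}).map (Ideal.Quotient.mk J) := ⟨_, rfl⟩
  obtain ⟨v, hv⟩ : ∃ v : Fin n → MvPolynomial (Fin n) k ⧸ J,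
      v = fun j => Ideal.Quotient.mk J (MvPolynomial.X j) ^ c j := ⟨_, rfl⟩
  have hc : ∀ j : Fin n, 0 < c j := fun j => Nat.pos_of_ne_zero fun h => by
    have h2 := (hwc j).2
    rw [h, zero_mul] at h2
    omega
  -- `X j ^ c j ∈ I_N`
  have hXcI : ∀ j : Fin n, (X j : MvPolynomial (Fin n) k) ^ c j ∈
      Ideal.span {m : MvPolynomial (Fin n) k | ∃ b : Fin n →₀ ℕ, N ≤ Finsupp.weight w b ∧
        m = MvPolynomial.monomial b 1} := by
    intro j
    rw [X_pow_eq_monomial]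
    refine WeightedConeCore.monomial_mem_weightIdeal w N _ ?_
    rw [Finsupp.weight_single, smul_eq_mul, (hwc j).2]
  -- `v j ∈ I`, `v j ≠ 0`, `I ≠ 0`
  have hvI : ∀ j : Fin n, v j ∈ I := by
    intro j
    rw [hv, hI]
    dsimp only
    rw [← map_pow]
    exact Ideal.mem_map_of_mem _ (hXcI j)
  have hv0 : ∀ j : Fin n, v j ≠ 0 := fun j => by
    rw [hv]
    exact pow_ne_zero _ (hXne j)
  have hI0 : I ≠ ⊥ := fun h => hv0 ⟨0, hn⟩ (by simpa [h] using hvI ⟨0, hn⟩)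
  -- the centre lies in the ideal of the variables
  have hIle : I ≤ Ideal.span (Set.range fun j : Fin n =>
      Ideal.Quotient.mk J (MvPolynomial.X j)) := by
    rw [hI, show (Set.range fun j : Fin n => Ideal.Quotient.mk J (MvPolynomial.X j)) =
      Ideal.Quotient.mk J '' Set.range (fun j : Fin n => (X j : MvPolynomial (Fin n) k)) from
      by rw [← Set.range_comp]; rfl, ← Ideal.map_span]
    exact Ideal.map_mono (WeightedConeCore.weightIdeal_le_span_X w N hN)
  -- THE COVER: every generator `x̄^b`, `wt b ≥ N`, has `(x̄^b)^{c_j} = x̄ⱼ^{c_j} · x̄^{b'}`, `x̄^{b'} ∈ I^{c_j - 1}`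
  have hcov : (HomogeneousIdeal.irrelevant (reesGrading I)).toIdeal ≤
      (Ideal.span (Set.range fun j : Fin n => reesT (I := I) (v j) (hvI j))).radical := by
    refine ReesCoverOfPowers.stub_reesCoverOfPowers _ I
      (Ideal.Quotient.mk J '' {m : MvPolynomial (Fin n) k | ∃ b : Fin n →₀ ℕ,
        N ≤ Finsupp.weight w b ∧ m = MvPolynomial.monomial b 1}) (by rw [hI, Ideal.map_span]) n v hvI ?_
    rintro _ ⟨_, ⟨b, hb, rfl⟩, rfl⟩
    -- `b ≠ 0`: pick a variable `j` occurring in `b`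
    obtain ⟨j, hj⟩ : ∃ j, b j ≠ 0 := by
      by_contra h
      push Not at h
      have hb0 : b = 0 := Finsupp.ext h
      subst hb0
      simp at hb
      omega
    have hle : Finsupp.single j (c j) ≤ c j • b := Finsupp.single_le_iff.mpr (by
      rw [Finsupp.smul_apply, smul_eq_mul]
      exact Nat.le_mul_of_pos_right _ (Nat.pos_of_ne_zero hj))
    have hsplit : c j • b = Finsupp.single j (c j) + (c j • b - Finsupp.single j (c j)) := by
      rw [add_comm, tsub_add_cancel_of_le hle]
    refine ⟨j, c j, hc j, Ideal.Quotient.mk J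
      (MvPolynomial.monomial (c j • b - Finsupp.single j (c j)) 1), ?_, ?_⟩
    · -- `x̄^{b'} ∈ I ^ (c_j - 1)` by the Veronese saturation hypothesis
      rw [hI, ← Ideal.map_pow]
      refine Ideal.mem_map_of_mem _ (hpow (c j - 1) _ ?_)
      have hwt : Finsupp.weight w (c j • b) =
          N + Finsupp.weight w (c j • b - Finsupp.single j (c j)) := by
        conv_lhs => rw [hsplit]
        rw [map_add, Finsupp.weight_single, smul_eq_mul, (hwc j).2]
      have hwt' : Finsupp.weight w (c j • b) = c j * Finsupp.weight w b := by
        rw [map_nsmul, smul_eq_mul]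
      have h1 : c j * N ≤ c j * Finsupp.weight w b := Nat.mul_le_mul_left _ hb
      have h2 : (c j - 1) * N + N = c j * N := by
        rcases Nat.exists_eq_succ_of_ne_zero (hc j).ne' with ⟨e, he⟩
        rw [he, Nat.succ_sub_one, Nat.succ_mul]
      omega
    · -- the identity `(x̄^b)^{c_j} = x̄ⱼ^{c_j} · x̄^{b'}`
      rw [hv]
      show _ = Ideal.Quotient.mk J (X j) ^ c j * _
      rw [← map_pow (Ideal.Quotient.mk J) (X j),
        ← map_pow (Ideal.Quotient.mk J) (MvPolynomial.monomial b (1 : k)), ← map_mul]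
      congr 1
      rw [MvPolynomial.monomial_pow, one_pow, X_pow_eq_monomial, MvPolynomial.monomial_mul, one_mul, ← hsplit]
  -- OFF THE CENTRE (Jacobson): a prime `P ⊉ I` generalises a closed point off the origin
  have hoff' : ∀ (P : Ideal (MvPolynomial (Fin n) k ⧸ J)) [P.IsPrime], ¬ I ≤ P →
      IsDomain (Localization.AtPrime P) ∧
      ∀ d : ℕ, ringKrullDim (Localization.AtPrime P) = d → ∀ s : Fin d → Localization.AtPrime P,
        (Ideal.span (Set.range s)).radical.IsMaximal →
          RingTheory.Sequence.IsWeaklyRegular (Localization.AtPrime P) (List.ofFn s) ∧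
          ∀ y : Localization.AtPrime P, (∃ e : ℕ, y ^ p ^ e ∈ Ideal.span
            ((fun z : Localization.AtPrime P => z ^ p ^ e) ''
              (Ideal.span (Set.range s) : Set (Localization.AtPrime P)))) → y ∈ Ideal.span (Set.range s) := by
    intro P _ hP
    obtain ⟨Q, hQ, hPQ, j, hj⟩ := exists_maximal_not_mem_X J I hIle P hP
    haveI := hQ
    exact ClauseOfMaximal.fiClause_atPrime_of_le p hPQ ⟨inferInstance, hoff Q ⟨j, hj⟩⟩
  -- ON THE EXCEPTIONAL LOCUS, chart by chart: the hypothesis `hon`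
  have hon' : ∀ (j : Fin n) (Q : Ideal (blowupAlgebra I (v j))) [Q.IsMaximal],
      algebraMap (MvPolynomial (Fin n) k ⧸ J) (blowupAlgebra I (v j)) (v j) ∈ Q →
      ∀ d : ℕ, ringKrullDim (Localization.AtPrime Q) = d → ∀ s : Fin d → Localization.AtPrime Q,
        (Ideal.span (Set.range s)).radical.IsMaximal →
          RingTheory.Sequence.IsWeaklyRegular (Localization.AtPrime Q) (List.ofFn s) ∧
          ∀ y : Localization.AtPrime Q, (∃ e : ℕ, y ^ p ^ e ∈ Ideal.span
            ((fun z : Localization.AtPrime Q => z ^ p ^ e) ''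
              (Ideal.span (Set.range s) : Set (Localization.AtPrime Q)))) → y ∈ Ideal.span (Set.range s) := by
    subst hI hv
    intro j Q _ hQ
    exact hon j Q hQ
  exact BlowupFiModelOfCover.stub_blowupFiModelOfCover p (MvPolynomial (Fin n) k ⧸ J) I n v
    hvI hI0 hv0 hcov hoff' hon'

end Summit.ResolutionOfSingularities.ResolutionOfSingularities.Theorems.FInjectiveMacaulayfication.GradedDomainConeCore
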